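import Literature.AlgebraicGeometry.Morphisms.GraphFamilyBaseChange
import Mathlib.AlgebraicGeometry.IdealSheaf.Functorial
import HarnessLib

/-!
# The piece `M_Q ⊂ V ⊂ HS_Q` of the Hom-scheme `Hom_S(Y, X)`: transport, closed and open conditions, SELF, comparison

Layer `Literature/AlgebraicGeometry/Morphisms`, namespace `Literature.AlgebraicGeometry.Morphisms`.  Theorems only: no definition, no
named fact, no instance, no notation, no `sorry`.  Universe `0` (that of the tree's Hilbert scheme ★ `Motives.exists_universal_flat_family`).

THE PRINTED PROOF ([MumfordFogartyKirwan1994] Ch. 0 §5 (c), p. 23; [FGA] no. 221 §4.c; Kollár, *Rational curves*, I.1.10): `Hom_S(Y, X)` is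
the open-of-closed locus of `Hilb(Y ×_S X ∕ S)` where the universal subscheme is the GRAPH of a morphism.  Fix a closed `S`-embedding
`jW : Y ×_S X ↪ 𝐏(ι; S)` (`hjW`), the Hilbert scheme `h : HS → S` of one polynomial with its universal family `iH : Z_H ↪ 𝐏(ι; HS)`, a closed
`c : V ↪ HS` over which the restricted family `iV : Z_V ↪ 𝐏(ι; V)` (`IsPullback gH iV iH 𝐏(c)`) lies INSIDE `W = Y ×_S X`, witnessed by
`a : Z_V → Y ×_S X` with `a ≫ jW = iV ≫ 𝐏(c ≫ h)` (`ha`), and an open `U ⊆ V` over which the projection `Z_V → Y_V` becomes an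
isomorphism, inverted by `σ : Y_U ≅ Z_U` (`hσ₁`, `hσ₂`); the universal morphism is `u := σ ≫ (Z_U → Z_V → Y ×_S X → X)` over `U` (`hu₁`, `hu₂`).
Everything is stated for ABSTRACT data subject to these equations (no `def`), so that the assembly
(`Morphisms/HomSchemePieceOfLayers`) instantiates them with Mathlib pull-backs by `obtain`.

* `exists_iso_baseChange_of_isPullback_graphFamily` — TRANSPORT: if the graph family `iΓ` of `φ : Y_T → X_T` is the pull-back of `iH` along
  `𝐏(b ≫ c)` (`b : T → V` over `v`), then `Y_T ≅ Z_V ×_V T` compatibly with the graph point `(pr_Y, φ ≫ pr_X)` (`jW` is a monomorphism).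
* `ker_comap_le_of_isPullback_graphFamily` — the CLOSED condition: such a `T`-point kills the ideal of `W` relative to `Z_H`
  (Mathlib `IdealSheafData.comap`, `ker_fst_of_isClosedImmersion`).
* `isIso_map_of_isPullback_graphFamily` — the OPEN condition: the base change of `Z_V → Y_V` along such a `w₁ : T → V` is an isomorphism.
* `piece_isPullback_graphFamily` — KEY: the graph family of `u` over `U` is the pull-back of `iH` along `𝐏(U ↪ V → HS)`;
  `piece_self` — hence it has at every field point of `U` whatever letters `Z_H ∕ HS` has (★ `letters_of_isPullback_projectiveSpaceMap`);
  `piece_comparison_eq` — and `φ` is the base change of `u` along the lift `w : T → U` (Mathlib comparison maps `pullback.map _ v _ m (𝟙 _) w (𝟙 S)`).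

Cell hodgecm-mathlib, F-4 (II-b) Hom-scheme, child line `F4IIbHomScheme` stub (B4) `stub_IIb4B4_pieceAssembly` (F0P1a-p02 (g0); lead B-p17 (g15),
skeleton B-p14 (g20), planner F0P1a-plan (g0)).  Count-neutral capital: HC_CM is proved only modulo the 7 printed citations until rung 0 closes;
nothing here bears on it.

## References
* D. Mumford, J. Fogarty, F. Kirwan, *Geometric Invariant Theory* (3rd ed., 1994), Ch. 0 §5 (c) (p. 23). [MumfordFogartyKirwan1994]
* A. Grothendieck, *FGA*, Sém. Bourbaki no. 221 (1960∕61), §4.c. [FGA]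
* U. Görtz, T. Wedhorn, *Algebraic Geometry I* (2nd ed., 2020), Section (4.7), Def. 9.7, Prop. 14.28 (p. 438). [GortzWedhorn2020]
* R. Hartshorne, *Algebraic Geometry*, GTM 52 (1977), III Thm. 9.9 (p. 261). [Hartshorne1977]
-/

noncomputable section

set_option backward.isDefEq.respectTransparency false

open CategoryTheory CategoryTheory.Limits CategoryTheory.Abelian AlgebraicGeometry Polynomial
open Literature.AlgebraicGeometry.Modules Literature.AlgebraicGeometry.Modules.SerreTwist

namespace Literature.AlgebraicGeometry.Morphisms

/-! ## The piece: abstract layer -/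

section Piece

variable {S Y X : Scheme.{0}} (q : Y ⟶ S) (p : X ⟶ S) {ι : Type} (jW : pullback q p ⟶ Morphisms.projectiveSpace ι S)
  (hjW : jW ≫ Morphisms.projectiveSpaceFst ι S = pullback.fst q p ≫ q)
  {HS : Scheme.{0}} (h : HS ⟶ S) {ZH : Scheme.{0}} (iH : ZH ⟶ Morphisms.projectiveSpace ι HS)
  {V : Scheme.{0}} (c : V ⟶ HS) {ZV : Scheme.{0}} (iV : ZV ⟶ Morphisms.projectiveSpace ι V) (gH : ZV ⟶ ZH)
  (HV : IsPullback gH iV iH (Morphisms.projectiveSpaceMap ι c))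
  (a : ZV ⟶ pullback q p) (ha : a ≫ jW = iV ≫ Morphisms.projectiveSpaceMap ι (c ≫ h))

include hjW ha in
/-- The `Y`-component of `Z_V → Y ×_S X` lies over `Z_V → V → HS → S`. [cite: MumfordFogartyKirwan1994, Ch. 0 §5 (c) (p. 23)] -/
theorem piece_fst_comp : (a ≫ pullback.fst q p) ≫ q = (iV ≫ Morphisms.projectiveSpaceFst ι V) ≫ c ≫ h := by
  rw [Category.assoc, ← hjW, ← Category.assoc a jW, ha, Category.assoc, Morphisms.projectiveSpaceMap_fst, Category.assoc]

include hjW ha in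
/-- The `X`-component of `Z_V → Y ×_S X` lies over `Z_V → V → HS → S`. [cite: MumfordFogartyKirwan1994, Ch. 0 §5 (c) (p. 23)] -/
theorem piece_snd_comp : (a ≫ pullback.snd q p) ≫ p = (iV ≫ Morphisms.projectiveSpaceFst ι V) ≫ c ≫ h := by
  rw [Category.assoc, ← pullback.condition, ← Category.assoc a, piece_fst_comp q p jW hjW h c iV a ha]

include HV ha in
/-- **Transport of a graph family along a classifying map.**  Let `iΓ` be the graph family of `φ : Y_T → X_T` and `b : T → V` with
`b ≫ c ≫ h = v` such that `iΓ` is the pull-back of `iH` along `𝐏(b ≫ c)`.  Then `Y_T ≅ Z_V ×_V T` by an isomorphism `σ` carrying the `T`-component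
to the `T`-component and whose `Z_V`-component followed by `a : Z_V → Y ×_S X` is the graph point `(pr_Y, φ ≫ pr_X)` (because `jW` is a
monomorphism and `a ≫ jW = iV ≫ 𝐏(c ≫ h)`). [cite: MumfordFogartyKirwan1994, Ch. 0 §5 (c) (p. 23)] [cite: GortzWedhorn2020, Section (4.7)] -/
theorem exists_iso_baseChange_of_isPullback_graphFamily [IsClosedImmersion jW] {T : Scheme.{0}} (v : T ⟶ S)
    (φ : pullback q v ⟶ pullback p v) (hw : pullback.fst q v ≫ q = (φ ≫ pullback.fst p v) ≫ p)
    (iΓ : pullback q v ⟶ Morphisms.projectiveSpace ι T) (h₁ : iΓ ≫ Morphisms.projectiveSpaceFst ι T = pullback.snd q v)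
    (h₂ : iΓ ≫ Morphisms.projectiveSpaceMap ι v = pullback.lift (pullback.fst q v) (φ ≫ pullback.fst p v) hw ≫ jW)
    (b : T ⟶ V) (hb : b ≫ c ≫ h = v) (ee : pullback q v ⟶ ZH)
    (Hee : IsPullback ee iΓ iH (Morphisms.projectiveSpaceMap ι (b ≫ c))) :
    ∃ σ : pullback q v ≅ pullback (iV ≫ Morphisms.projectiveSpaceFst ι V) b,
      σ.hom ≫ pullback.fst _ _ ≫ a = pullback.lift (pullback.fst q v) (φ ≫ pullback.fst p v) hw ∧
      σ.hom ≫ pullback.snd _ _ = pullback.snd q v := by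
  have HT := IsPullback.of_hasPullback (iV ≫ Morphisms.projectiveSpaceFst ι V) b
  obtain ⟨iT, hiT₁, hiT₂⟩ := exists_embedding_baseChange iV b _ _ HT
  have HZT := isPullback_family_baseChange c iH iV gH b _ _ HV HT iT hiT₁ hiT₂
  refine ⟨Hee.isoIsPullback _ _ HZT, ?_, ?_⟩
  · rw [← cancel_mono jW, Category.assoc, Category.assoc, ha, ← reassoc_of% hiT₁, ← projectiveSpaceMap_comp,
      Hee.isoIsPullback_hom_snd_assoc _ _ HZT, hb, h₂]
  · rw [← hiT₂, Hee.isoIsPullback_hom_snd_assoc _ _ HZT, h₁]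

/-- **The closed condition.**  If the graph family `iΓ ⊂ 𝐏(ι; T)` (`iΓ ≫ 𝐏(v) = wΓ ≫ jW`) is the pull-back of `iH` along `𝐏(w₀)`
(`w₀ ≫ h = v`), then the pulled-back universal family lies inside the pulled-back `W = Y ×_S X`: `𝓘(W_{HS})·𝒪_{𝐏(T)} ≤ 𝓘(Z_H)·𝒪_{𝐏(T)}`
(Mathlib `IdealSheafData.comap` along `𝐏(w₀)`), since `iΓ` factors through `W_T`. [cite: MumfordFogartyKirwan1994, Ch. 0 §5 (c) (p. 23)] -/
theorem ker_comap_le_of_isPullback_graphFamily [IsClosedImmersion jW] [IsClosedImmersion iH] {T : Scheme.{0}} (v : T ⟶ S)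
    (w₀ : T ⟶ HS) (hw₀ : w₀ ≫ h = v) {YT : Scheme.{0}} (iΓ : YT ⟶ Morphisms.projectiveSpace ι T) (wΓ : YT ⟶ pullback q p)
    (h₂ : iΓ ≫ Morphisms.projectiveSpaceMap ι v = wΓ ≫ jW) (ee : YT ⟶ ZH)
    (Hee : IsPullback ee iΓ iH (Morphisms.projectiveSpaceMap ι w₀)) :
    (pullback.snd jW (Morphisms.projectiveSpaceMap ι h)).ker.comap (Morphisms.projectiveSpaceMap ι w₀) ≤
      iH.ker.comap (Morphisms.projectiveSpaceMap ι w₀) := by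
  haveI : IsClosedImmersion (pullback.snd jW (Morphisms.projectiveSpaceMap ι h)) :=
    MorphismProperty.pullback_snd _ _ inferInstance
  rw [← Scheme.IdealSheafData.ker_fst_of_isClosedImmersion, ← Scheme.IdealSheafData.ker_fst_of_isClosedImmersion]
  have H2 : IsPullback (pullback.snd (Morphisms.projectiveSpaceMap ι w₀) iH) (pullback.fst (Morphisms.projectiveSpaceMap ι w₀) iH)
      iH (Morphisms.projectiveSpaceMap ι w₀) := (IsPullback.of_hasPullback _ _).flip
  have hker : (pullback.fst (Morphisms.projectiveSpaceMap ι w₀) iH).ker = iΓ.ker := by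
    rw [← Hee.isoIsPullback_hom_snd _ _ H2, Scheme.Hom.ker_comp_of_isIso]
  rw [hker]
  have hℓ : wΓ ≫ jW = (iΓ ≫ Morphisms.projectiveSpaceMap ι w₀) ≫ Morphisms.projectiveSpaceMap ι h := by
    rw [Category.assoc, ← projectiveSpaceMap_comp, hw₀, h₂]
  calc (pullback.fst (Morphisms.projectiveSpaceMap ι w₀) (pullback.snd jW (Morphisms.projectiveSpaceMap ι h))).ker
      ≤ (pullback.lift iΓ (pullback.lift wΓ (iΓ ≫ Morphisms.projectiveSpaceMap ι w₀) hℓ) (by rw [pullback.lift_snd]) ≫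
          pullback.fst (Morphisms.projectiveSpaceMap ι w₀) (pullback.snd jW (Morphisms.projectiveSpaceMap ι h))).ker :=
        Scheme.Hom.le_ker_comp _ _
    _ = iΓ.ker := by rw [pullback.lift_fst]

include HV ha in
/-- **The open condition.**  If the graph family of `φ` over `T` is the pull-back of `iH` along `𝐏(w₁ ≫ c)` (`w₁ : T → V` over `v`), then the
base change `Z_V ×_V T → Y_V ×_V T` of the projection `gY : Z_V → Y_V` is an ISOMORPHISM (both sides are `Y_T`, and under these identifications
the map is the identity: its graph point is `(pr_Y, φ ≫ pr_X)`). [cite: MumfordFogartyKirwan1994, Ch. 0 §5 (c) (p. 23)]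
[cite: GortzWedhorn2020, Proposition 14.28 (p. 438)] -/
theorem isIso_map_of_isPullback_graphFamily [IsClosedImmersion jW] {T : Scheme.{0}} (v : T ⟶ S)
    (φ : pullback q v ⟶ pullback p v) (hw : pullback.fst q v ≫ q = (φ ≫ pullback.fst p v) ≫ p)
    (iΓ : pullback q v ⟶ Morphisms.projectiveSpace ι T) (h₁ : iΓ ≫ Morphisms.projectiveSpaceFst ι T = pullback.snd q v)
    (h₂ : iΓ ≫ Morphisms.projectiveSpaceMap ι v = pullback.lift (pullback.fst q v) (φ ≫ pullback.fst p v) hw ≫ jW)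
    (w₁ : T ⟶ V) (hw₁ : w₁ ≫ c ≫ h = v) (ee : pullback q v ⟶ ZH)
    (Hee : IsPullback ee iΓ iH (Morphisms.projectiveSpaceMap ι (w₁ ≫ c)))
    (gY : ZV ⟶ pullback q (c ≫ h)) (hgY₁ : gY ≫ pullback.fst q (c ≫ h) = a ≫ pullback.fst q p)
    (hgY₂ : gY ≫ pullback.snd q (c ≫ h) = iV ≫ Morphisms.projectiveSpaceFst ι V) :
    IsIso (pullback.map (iV ≫ Morphisms.projectiveSpaceFst ι V) w₁ (pullback.snd q (c ≫ h)) w₁ gY (𝟙 T) (𝟙 V)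
      (by rw [Category.comp_id, hgY₂]) (by rw [Category.comp_id, Category.id_comp])) := by
  obtain ⟨σ, hσa, hσ₂⟩ :=
    exists_iso_baseChange_of_isPullback_graphFamily q p jW h iH c iV gH HV a ha v φ hw iΓ h₁ h₂ w₁ hw₁ ee Hee
  -- `τ : Y_T ≅ Y_V ×_V T`
  have Hτ : IsPullback (pullback.fst (pullback.snd q (c ≫ h)) w₁ ≫ pullback.fst q (c ≫ h))
      (pullback.snd (pullback.snd q (c ≫ h)) w₁) q v := by
    have H := ((IsPullback.of_hasPullback (pullback.snd q (c ≫ h)) w₁).flip.paste_vert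
      (IsPullback.of_hasPullback q (c ≫ h)).flip).flip
    rw [hw₁] at H
    exact H
  have key : σ.hom ≫ pullback.map (iV ≫ Morphisms.projectiveSpaceFst ι V) w₁ (pullback.snd q (c ≫ h)) w₁ gY (𝟙 T) (𝟙 V)
      (by rw [Category.comp_id, hgY₂]) (by rw [Category.comp_id, Category.id_comp]) =
      ((IsPullback.of_hasPullback q v).isoIsPullback _ _ Hτ).hom := by
    have hc1 : pullback.fst (iV ≫ Morphisms.projectiveSpaceFst ι V) w₁ ≫ iV ≫ Morphisms.projectiveSpaceFst ι V =
        pullback.snd (iV ≫ Morphisms.projectiveSpaceFst ι V) w₁ ≫ w₁ := by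
      simpa only [Category.assoc] using pullback.condition
    apply pullback.hom_ext
    · apply pullback.hom_ext
      · simp only [Category.assoc, pullback.lift_fst_assoc, IsPullback.isoIsPullback_hom_fst]
        rw [hgY₁, reassoc_of% hσa, pullback.lift_fst]
      · simp only [Category.assoc, pullback.lift_fst_assoc]
        rw [hgY₂, hc1, reassoc_of% hσ₂, pullback.condition, IsPullback.isoIsPullback_hom_snd_assoc]
    · simp only [Category.assoc, pullback.lift_snd, Category.comp_id]
      rw [hσ₂, IsPullback.isoIsPullback_hom_snd]
  have hmap : pullback.map (iV ≫ Morphisms.projectiveSpaceFst ι V) w₁ (pullback.snd q (c ≫ h)) w₁ gY (𝟙 T) (𝟙 V)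
      (by rw [Category.comp_id, hgY₂]) (by rw [Category.comp_id, Category.id_comp]) =
      σ.inv ≫ ((IsPullback.of_hasPullback q v).isoIsPullback _ _ Hτ).hom := by
    rw [← key, Iso.inv_hom_id_assoc]
  rw [hmap]
  infer_instance

variable (U : V.Opens) (u : pullback q (U.ι ≫ c ≫ h) ⟶ pullback p (U.ι ≫ c ≫ h))
  (σ : pullback q (U.ι ≫ c ≫ h) ⟶ pullback (iV ≫ Morphisms.projectiveSpaceFst ι V) U.ι)
  (hσ₁ : σ ≫ pullback.fst _ _ ≫ a ≫ pullback.fst q p = pullback.fst q _)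
  (hσ₂ : σ ≫ pullback.snd _ _ = pullback.snd q _)
  (hu₁ : u ≫ pullback.fst p _ = σ ≫ pullback.fst _ _ ≫ a ≫ pullback.snd q p)
  (hu₂ : u ≫ pullback.snd p _ = pullback.snd q _)

include hσ₁ hu₁ in
/-- The graph point of `u` is `σ` followed by `Z_U → Z_V → Y ×_S X`. [cite: MumfordFogartyKirwan1994, Ch. 0 §5 (c) (p. 23)] -/
theorem piece_graphPoint (hw : pullback.fst q (U.ι ≫ c ≫ h) ≫ q = (u ≫ pullback.fst p (U.ι ≫ c ≫ h)) ≫ p) :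
    σ ≫ pullback.fst _ _ ≫ a = pullback.lift (pullback.fst q _) (u ≫ pullback.fst p _) hw := by
  apply pullback.hom_ext
  · rw [pullback.lift_fst, Category.assoc, Category.assoc, hσ₁]
  · rw [pullback.lift_snd, Category.assoc, Category.assoc, hu₁]

include ha hσ₁ hσ₂ hu₁ HV in
/-- **KEY: the graph family of `u` over `M = U` is the pull-back of the universal family `iH` along `𝐏(U ↪ V → HS)`** (`σ` identifies
`Y_M` with `Z_U = Z_V ×_V U ⊂ 𝐏(ι; U)`, itself the pull-back of `iH` along `𝐏(U.ι ≫ c)` by pasting).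
[cite: MumfordFogartyKirwan1994, Ch. 0 §5 (c) (p. 23)] -/
theorem piece_isPullback_graphFamily [IsIso σ]
    (hw : pullback.fst q (U.ι ≫ c ≫ h) ≫ q = (u ≫ pullback.fst p (U.ι ≫ c ≫ h)) ≫ p)
    (iΓ : pullback q (U.ι ≫ c ≫ h) ⟶ Morphisms.projectiveSpace ι U)
    (h₁ : iΓ ≫ Morphisms.projectiveSpaceFst ι U = pullback.snd q _)
    (h₂ : iΓ ≫ Morphisms.projectiveSpaceMap ι (U.ι ≫ c ≫ h) =
      pullback.lift (pullback.fst q _) (u ≫ pullback.fst p _) hw ≫ jW) :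
    IsPullback (σ ≫ pullback.fst _ _ ≫ gH) iΓ iH (Morphisms.projectiveSpaceMap ι (U.ι ≫ c)) := by
  have HT := IsPullback.of_hasPullback (iV ≫ Morphisms.projectiveSpaceFst ι V) U.ι
  obtain ⟨iT, hiT₁, hiT₂⟩ := exists_embedding_baseChange iV U.ι _ _ HT
  have HZU := isPullback_family_baseChange c iH iV gH U.ι _ _ HV HT iT hiT₁ hiT₂
  -- `σ ≫ iT = iΓ`: compare in `𝐏(ι; U) = 𝐏(ι; S) ×_S U`
  have hσiT : σ ≫ iT = iΓ := by
    apply (Morphisms.isPullback_projectiveSpaceMap ι (U.ι ≫ c ≫ h)).hom_ext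
    · rw [h₂, ← piece_graphPoint q p h c iV a U u σ hσ₁ hu₁ hw, projectiveSpaceMap_comp ι U.ι (c ≫ h)]
      simp only [Category.assoc]
      rw [reassoc_of% hiT₁, ha]
    · rw [Category.assoc, hiT₂, hσ₂, h₁]
  refine HZU.of_iso (asIso σ).symm (Iso.refl _) (Iso.refl _) (Iso.refl _) ?_ ?_ (by simp) (by simp)
  · simp
  · rw [← hσiT]; simp

include ha hσ₁ hσ₂ hu₁ HV in
/-- **SELF: the graph family of `u_Q` has the letters of the universal family.**  At a field point `x` of `M = U` the fibre of the graph of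
`u` is the fibre of `Z_H` at `x ≫ U.ι ≫ c`, with the same twisted structure sheaf; so whatever letters `Z_H ∕ HS` has at every field
point (here: `Ext¹ = 0` and `h⁰ = Q(e)` for `e ≥ B(Q) − 1`), the graph family of `u` has at every field point of `M`.
[cite: MumfordFogartyKirwan1994, Ch. 0 §5 (c) (p. 23)] [cite: Hartshorne1977, III Thm. 9.9 (p. 261)] -/
theorem piece_self [IsIso σ] (B : ℤ) (Q : ℚ[X])
    (hselfH : ∀ ⦃K : Type⦄ [Field K] ⦃X₀ : Scheme.{0}⦄ (k : X₀ ⟶ ZH) (f₀ : X₀ ⟶ Spec (CommRingCat.of K))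
      (x : Spec (CommRingCat.of K) ⟶ HS), IsPullback k f₀ (iH ≫ Morphisms.projectiveSpaceFst ι HS) x →
      ∀ e : ℕ, B ≤ (e : ℤ) →
        Subsingleton (CategoryTheory.Abelian.Ext.{1} (unitModule X₀) ((Scheme.Modules.pullback k).obj
          (twistMod (iH ≫ pullback.snd (terminal.from HS) (terminal.from (Morphisms.projectiveSpaceInt ι))) (unitModule _) e)) 1) ∧
        ((Module.finrank Γ(Spec (CommRingCat.of K), ⊤) (SecMod ((Scheme.Modules.pullback k).obj
          (twistMod (iH ≫ pullback.snd (terminal.from HS) (terminal.from (Morphisms.projectiveSpaceInt ι))) (unitModule _) e))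
          f₀.appTop.hom ⊤) : ℕ) : ℚ) = Q.eval (e : ℚ))
    (hw : pullback.fst q (U.ι ≫ c ≫ h) ≫ q = (u ≫ pullback.fst p (U.ι ≫ c ≫ h)) ≫ p)
    (iΓ : pullback q (U.ι ≫ c ≫ h) ⟶ Morphisms.projectiveSpace ι U)
    (h₁ : iΓ ≫ Morphisms.projectiveSpaceFst ι U = pullback.snd q _)
    (h₂ : iΓ ≫ Morphisms.projectiveSpaceMap ι (U.ι ≫ c ≫ h) = pullback.lift (pullback.fst q _) (u ≫ pullback.fst p _) hw ≫ jW)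
    ⦃K : Type⦄ [Field K] ⦃X₀ : Scheme.{0}⦄ (k : X₀ ⟶ pullback q (U.ι ≫ c ≫ h)) (f₀ : X₀ ⟶ Spec (CommRingCat.of K))
    (x : Spec (CommRingCat.of K) ⟶ U) (H : IsPullback k f₀ (iΓ ≫ Morphisms.projectiveSpaceFst ι U) x) (e : ℕ) (he : B ≤ (e : ℤ)) :
    Subsingleton (CategoryTheory.Abelian.Ext.{1} (unitModule X₀) ((Scheme.Modules.pullback k).obj
      (twistMod (iΓ ≫ pullback.snd (terminal.from (U : Scheme.{0})) (terminal.from (Morphisms.projectiveSpaceInt ι))) (unitModule _) e)) 1) ∧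
    ((Module.finrank Γ(Spec (CommRingCat.of K), ⊤) (SecMod ((Scheme.Modules.pullback k).obj
      (twistMod (iΓ ≫ pullback.snd (terminal.from (U : Scheme.{0})) (terminal.from (Morphisms.projectiveSpaceInt ι))) (unitModule _) e))
      f₀.appTop.hom ⊤) : ℕ) : ℚ) = Q.eval (e : ℚ) :=
  letters_of_isPullback_projectiveSpaceMap iH (U.ι ≫ c) (σ ≫ pullback.fst _ _ ≫ gH) iΓ
    (piece_isPullback_graphFamily q p jW h iH c iV gH HV a ha U u σ hσ₁ hσ₂ hu₁ hw iΓ h₁ h₂) k f₀ x H e (Q.eval (e : ℚ))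
    fun k₁ H₁ => hselfH k₁ f₀ (x ≫ U.ι ≫ c) H₁ e he

include HV ha hσ₁ hσ₂ hu₁ hu₂ in
/-- **The universal morphism pulls back to `φ`.**  If the graph family of `φ` over `T` is the pull-back of `iH` along `𝐏((w ≫ U.ι) ≫ c)` for
some `w : T → M = U` over `v`, then `φ` is the base change of `u` along `w` (both have the graph point `(pr_Y, φ ≫ pr_X)`; compare the
`X`- and `T`-components). [cite: MumfordFogartyKirwan1994, Ch. 0 §5 (c) (p. 23)] -/
theorem piece_comparison_eq [IsClosedImmersion jW] [IsIso σ] {T : Scheme.{0}} (v : T ⟶ S) (φ : pullback q v ⟶ pullback p v)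
    (hφ : φ ≫ pullback.snd p v = pullback.snd q v) (hw : pullback.fst q v ≫ q = (φ ≫ pullback.fst p v) ≫ p)
    (iΓ : pullback q v ⟶ Morphisms.projectiveSpace ι T) (h₁ : iΓ ≫ Morphisms.projectiveSpaceFst ι T = pullback.snd q v)
    (h₂ : iΓ ≫ Morphisms.projectiveSpaceMap ι v = pullback.lift (pullback.fst q v) (φ ≫ pullback.fst p v) hw ≫ jW)
    (w : T ⟶ U) (hwv : w ≫ U.ι ≫ c ≫ h = v) (ee : pullback q v ⟶ ZH)
    (Hee : IsPullback ee iΓ iH (Morphisms.projectiveSpaceMap ι ((w ≫ U.ι) ≫ c))) :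
    φ ≫ pullback.map p v p (U.ι ≫ c ≫ h) (𝟙 X) w (𝟙 S) (by simp) (by simpa using hwv.symm) =
      pullback.map q v q (U.ι ≫ c ≫ h) (𝟙 Y) w (𝟙 S) (by simp) (by simpa using hwv.symm) ≫ u := by
  obtain ⟨σT, hσTa, hσT₂⟩ := exists_iso_baseChange_of_isPullback_graphFamily q p jW h iH c iV gH HV a ha v φ hw iΓ h₁ h₂
    (w ≫ U.ι) (by simpa only [Category.assoc] using hwv) ee Hee
  have hσ₁' : inv σ ≫ pullback.fst q (U.ι ≫ c ≫ h) = pullback.fst _ _ ≫ a ≫ pullback.fst q p := by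
    rw [← hσ₁, IsIso.inv_hom_id_assoc]
  have hσ₂' : inv σ ≫ pullback.snd q (U.ι ≫ c ≫ h) = pullback.snd _ _ := by rw [← hσ₂, IsIso.inv_hom_id_assoc]
  -- `(Y-comparison) = σT ≫ (Z_T → Z_U) ≫ σ⁻¹`
  have C : pullback.map q v q (U.ι ≫ c ≫ h) (𝟙 Y) w (𝟙 S) (by simp) (by simpa using hwv.symm) =
      σT.hom ≫ pullback.map (iV ≫ Morphisms.projectiveSpaceFst ι V) (w ≫ U.ι) (iV ≫ Morphisms.projectiveSpaceFst ι V) U.ι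
        (𝟙 ZV) w (𝟙 V) (by simp) (by simp) ≫ inv σ := by
    apply pullback.hom_ext
    · simp only [Category.assoc, pullback.lift_fst, Category.comp_id]
      rw [hσ₁', pullback.lift_fst_assoc, Category.comp_id, reassoc_of% hσTa, pullback.lift_fst]
    · simp only [Category.assoc, pullback.lift_snd]
      rw [hσ₂', pullback.lift_snd, reassoc_of% hσT₂]
  have C' : pullback.map q v q (U.ι ≫ c ≫ h) (𝟙 Y) w (𝟙 S) (by simp) (by simpa using hwv.symm) ≫ σ =
      σT.hom ≫ pullback.map (iV ≫ Morphisms.projectiveSpaceFst ι V) (w ≫ U.ι) (iV ≫ Morphisms.projectiveSpaceFst ι V) U.ι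
        (𝟙 ZV) w (𝟙 V) (by simp) (by simp) := by
    rw [C]; simp only [Category.assoc, IsIso.inv_hom_id, Category.comp_id]
  apply pullback.hom_ext
  · simp only [Category.assoc, pullback.lift_fst, Category.comp_id]
    rw [hu₁, reassoc_of% C', pullback.lift_fst_assoc, Category.comp_id, reassoc_of% hσTa, pullback.lift_snd]
  · simp only [Category.assoc, pullback.lift_snd]
    rw [hu₂, pullback.lift_snd, reassoc_of% hφ]

end Piece

end Literature.AlgebraicGeometry.Morphisms

end
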